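import Mathlib
import Summits.KontsevichZagierPeriods.Zeta5Search.LeadingDigitSeries
import Summits.KontsevichZagierPeriods.Zeta5Search.ClusterBoundProof
import Summits.KontsevichZagierPeriods.Zeta5Search.ZeroEvaluationProof
import HarnessLib

/-!
# ζ(5) search — the conjugation sign of the unit `ĝ_q`: `ĝ_{b₀−q} = (−1)^{E_x+1}·ĝ_q` (gen-2 g9's G2), exact

Cell `pub-zeta5` (HONEST FRAMING: systematic search; no irrationality claim unless certified), P1 prover seat
generation 5.  gen-2 g9 (REPORT-gen2-g9 §1.4, statement `GHatConj` of the staged `G9UniversalDigit.lean`, exact check 110,364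
classes): for a residue class `x` NOT containing the centre and `q ∈ x`, **`ĝ_{b₀−q} = (−1)^{E_x+1}·ĝ_q`**.  Mechanism: the
reflection `s ↦ b₀ − s` preserves the net exponents (`netExp_reflect`) and maps the complement of the class of `q` onto the
complement of the class of `b₀ − q`; every factor picks up `(−1)^{netExp s}`, the odd-centre factor picks up `−1`, and the TOTAL
net exponent `Σ_s netExp s = 2(Σ_j b_j − 3(b₀+1)) + [2 ∣ b₀]` (`sum_netExp_eq`) has the parity of `[2 ∣ b₀]` — which is the
oddness of `R_b` under the well-poised reflection.  Proved with literally gen-2's statement body (`gHat_conj`); this is the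
sign by which the `V`-digits of a symmetric ("even palindromic") conjugate pair cancel.  Identities of rational numbers;
nothing about irrationality.
-/

noncomputable section

open Finset

namespace Summit.KontsevichZagierPeriods.Zeta5Search.CellA

open Summit.KontsevichZagierPeriods.Zeta5Search.DualSeries (InBox)
open Summit.KontsevichZagierPeriods.Zeta5Search.CasoratianValuation (InPolytope)
open Summit.KontsevichZagierPeriods.Zeta5Search.ClusterValuation
open Summit.KontsevichZagierPeriods.Zeta5Search.BigPrime (block)

/-! ### Reflection of the net exponents and the total net exponent -/

/-- `blockCount` is symmetric under `s ↦ b₀ − s`. -/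
theorem blockCount_reflect (b : ℕ → ℤ) {s : ℕ} (hs : s ≤ (b 0).toNat) :
    blockCount b ((b 0).toNat - s) = blockCount b s := by
  unfold blockCount
  congr 1
  ext j
  simp only [mem_filter, block, mem_Icc, and_congr_right_iff]
  intro _; omega

/-- **`netExp (b₀ − s) = netExp s`.** -/
theorem netExp_reflect (b : ℕ → ℤ) (h0 : 0 ≤ b 0) {s : ℕ} (hs : s ≤ (b 0).toNat) :
    netExp b ((b 0).toNat - s) = netExp b s := by
  have hb0 : b 0 = ((b 0).toNat : ℤ) := (Int.toNat_of_nonneg h0).symm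
  unfold netExp
  rw [blockCount_reflect b hs]
  have : (2 * (((b 0).toNat - s : ℕ) : ℤ) = b 0) ↔ (2 * (s : ℤ) = b 0) := by rw [hb0]; omega
  simp only [this]

/-- The total depth: `Σ_{s ≤ b₀} blockCount s = Σ_j (b₀ − 2b_j + 1)` (each block lies in `[0, b₀]` when `2b_j ≤ b₀`). -/
theorem sum_blockCount_eq (b : ℕ → ℤ) (hb : InPolytope b) :
    ∑ s ∈ range ((b 0).toNat + 1), (blockCount b s : ℤ) =
      ∑ j ∈ range 7, (((b 0).toNat : ℤ) - 2 * ((b (j + 1)).toNat : ℤ) + 1) := by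
  have hcnt : ∀ s, (blockCount b s : ℤ) = ∑ j ∈ range 7, (if s ∈ block (b 0).toNat (b (j + 1)).toNat then (1 : ℤ) else 0) := by
    intro s; unfold blockCount; rw [card_filter]; push_cast; rfl
  rw [sum_congr rfl fun s _ => hcnt s, sum_comm]
  refine sum_congr rfl fun j hj => ?_
  have h2 : 2 * (b (j + 1)).toNat ≤ (b 0).toNat := by
    have := hb.2.1 j hj; have := (hb.1.2 j hj).1; have := hb.1.1; omega
  rw [← sum_filter, sum_const, nsmul_eq_mul, mul_one]
  have : (range ((b 0).toNat + 1)).filter (fun s => s ∈ block (b 0).toNat (b (j + 1)).toNat) =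
      block (b 0).toNat (b (j + 1)).toNat := by
    ext s; simp only [mem_filter, mem_range, block, mem_Icc]; omega
  rw [this, block, Nat.card_Icc]
  omega

/-- **The total net exponent**: `Σ_{s ≤ b₀} netExp s = 2·(Σ_j b_j − 3(b₀+1)) + [2 ∣ b₀]`. -/
theorem sum_netExp_eq (b : ℕ → ℤ) (hb : InPolytope b) :
    ∑ s ∈ range ((b 0).toNat + 1), netExp b s =
      2 * ((∑ j ∈ range 7, ((b (j + 1)).toNat : ℤ)) - 3 * (((b 0).toNat : ℤ) + 1)) + (if (2 : ℤ) ∣ b 0 then 1 else 0) := by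
  have h0 : 0 ≤ b 0 := hb.1.1
  have hb0 : b 0 = ((b 0).toNat : ℤ) := (Int.toNat_of_nonneg h0).symm
  have hsplit : ∑ s ∈ range ((b 0).toNat + 1), netExp b s =
      ∑ s ∈ range ((b 0).toNat + 1), ((1 : ℤ) - blockCount b s) +
        ∑ s ∈ range ((b 0).toNat + 1), (if 2 * (s : ℤ) = b 0 then (1 : ℤ) else 0) := by
    rw [← sum_add_distrib]; rfl
  have hcen : ∑ s ∈ range ((b 0).toNat + 1), (if 2 * (s : ℤ) = b 0 then (1 : ℤ) else 0) =
      if (2 : ℤ) ∣ b 0 then 1 else 0 := by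
    rw [← sum_filter]
    by_cases hev : (2 : ℤ) ∣ b 0
    · obtain ⟨m, hm⟩ := hev
      have hm0 : 0 ≤ m := by omega
      have : (range ((b 0).toNat + 1)).filter (fun s : ℕ => 2 * (s : ℤ) = b 0) = ({Int.toNat m} : Finset ℕ) := by
        ext s; simp only [mem_filter, mem_range, mem_singleton]; omega
      rw [this, sum_singleton, if_pos ⟨m, hm⟩]
    · have : (range ((b 0).toNat + 1)).filter (fun s : ℕ => 2 * (s : ℤ) = b 0) = ∅ := by
        ext s; simp only [mem_filter, mem_range, notMem_empty, iff_false, not_and]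
        intro _ h; exact hev ⟨s, by omega⟩
      rw [this, sum_empty, if_neg hev]
  rw [hsplit, hcen, sum_sub_distrib, sum_blockCount_eq b hb, sum_const, card_range, nsmul_eq_mul, mul_one]
  have e7 : ∑ j ∈ range 7, (((b 0).toNat : ℤ) - 2 * ((b (j + 1)).toNat : ℤ) + 1) =
      7 * (((b 0).toNat : ℤ) + 1) - 2 * ∑ j ∈ range 7, ((b (j + 1)).toNat : ℤ) := by
    rw [sum_add_distrib, sum_sub_distrib, sum_const, card_range, nsmul_eq_mul, ← mul_sum, sum_const, card_range,
      nsmul_eq_mul]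
    push_cast; ring
  rw [e7]; push_cast; ring

/-- The parity consequence: `(−1)^{Σ_s netExp s} = (−1)^{[2 ∣ b₀]}`. -/
theorem neg_one_zpow_sum_netExp (b : ℕ → ℤ) (hb : InPolytope b) :
    (-1 : ℚ) ^ (∑ s ∈ range ((b 0).toNat + 1), netExp b s) = if (2 : ℤ) ∣ b 0 then -1 else 1 := by
  rw [sum_netExp_eq b hb, zpow_add₀ (by norm_num : (-1 : ℚ) ≠ 0), zpow_mul, show ((-1 : ℚ) ^ (2 : ℤ)) = 1 by norm_num,
    one_zpow, one_mul]
  split_ifs <;> simp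

/-! ### G2 -/

/-- `(−u)^e = (−1)^e·u^e` for `e : ℤ`. -/
theorem neg_zpow' (u : ℚ) (e : ℤ) : (-u) ^ e = (-1 : ℚ) ^ e * u ^ e := by
  rw [← mul_zpow, neg_one_mul]

/-- **G2 (gen-2 g9, `GHatConj`)**: the conjugation sign of `ĝ`, exactly. -/
theorem gHat_conj : ∀ (b : ℕ → ℤ) (p x q : ℕ), InPolytope b → p.Prime → 5 ≤ p → x < p → ¬ CentreIn b p x →
    q ∈ classSet b p x → gHat b p ((b 0).toNat - q) = (-1 : ℚ) ^ (classExp b p x + 1) * gHat b p q := by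
  intro b p x q hb hprime hp5 hx hcx hq
  have h0 : 0 ≤ b 0 := hb.1.1
  set N := (b 0).toNat with hN
  have hb0 : b 0 = (N : ℤ) := (Int.toNat_of_nonneg h0).symm
  have hqN : q ≤ N := by have := ((mem_classSet_iff b x q).1 hq).1; rwa [← hN] at this
  have hqx : q % p = x % p := (mem_filter.1 hq).2
  have hcq : ¬ CentreIn b p q := fun h => hcx ((centreIn_iff_of_mem hq).1 h)
  have hcq' : ¬ CentreIn b p (N - q) := by
    intro h; apply hcq
    unfold CentreIn at h ⊢
    have e : 2 * (((N - q : ℕ) : ℤ)) - b 0 = -(2 * (q : ℤ) - b 0) := by rw [hb0]; omega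
    rw [e, dvd_neg] at h; exact h
  -- the foreign products, reflected
  set F : ℕ → Finset ℕ := fun r => (range (N + 1)).filter (fun s => s % p ≠ r % p) with hF
  have hmemF : ∀ {r s : ℕ}, s ∈ F r ↔ s ≤ N ∧ ¬ (p : ℤ) ∣ (s : ℤ) - r := by
    intro r s
    rw [hF]; simp only [mem_filter, mem_range, Nat.lt_succ_iff]
    have : (p : ℤ) ∣ (s : ℤ) - r ↔ s % p = r % p := by
      rw [dvd_sub_comm]; exact (Nat.modEq_iff_dvd).symm
    rw [this]
  have hprod : ∏ s ∈ F (N - q), ((s : ℚ) - ((N - q : ℕ) : ℚ)) ^ netExp b s =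
      ∏ s ∈ F q, ((((N - s : ℕ) : ℚ)) - ((N - q : ℕ) : ℚ)) ^ netExp b (N - s) := by
    refine (prod_nbij' (fun s => N - s) (fun s => N - s) (fun s hs => ?_) (fun s hs => ?_) (fun s hs => ?_)
      (fun s hs => ?_) (fun s hs => rfl)).symm
    · obtain ⟨hsN, hnd⟩ := hmemF.1 hs
      refine hmemF.2 ⟨by omega, fun h => hnd ?_⟩
      have e : (s : ℤ) - q = -((((N - s : ℕ) : ℤ)) - ((N - q : ℕ) : ℤ)) := by omega
      rw [e]; exact h.neg_right
    · obtain ⟨hsN, hnd⟩ := hmemF.1 hs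
      refine hmemF.2 ⟨by omega, fun h => hnd ?_⟩
      have e : (s : ℤ) - ((N - q : ℕ) : ℤ) = -((((N - s : ℕ) : ℤ)) - q) := by omega
      rw [e]; exact h.neg_right
    · have := (hmemF.1 hs).1; omega
    · have := (hmemF.1 hs).1; omega
  have hfac : ∀ s ∈ F q, ((((N - s : ℕ) : ℚ)) - ((N - q : ℕ) : ℚ)) ^ netExp b (N - s) =
      (-1 : ℚ) ^ netExp b s * ((s : ℚ) - q) ^ netExp b s := by
    intro s hs
    have hsN := (hmemF.1 hs).1
    rw [netExp_reflect b h0 (by rw [← hN]; exact hsN)]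
    have e : ((((N - s : ℕ) : ℚ)) - ((N - q : ℕ) : ℚ)) = -((s : ℚ) - q) := by
      push_cast [Nat.cast_sub hsN, Nat.cast_sub hqN]; ring
    rw [e, neg_zpow']
  have hsign : ∏ s ∈ F q, (-1 : ℚ) ^ netExp b s = (-1 : ℚ) ^ (∑ s ∈ F q, netExp b s) :=
    prod_zpow_eq _ _ (by norm_num)
  -- the exponent bookkeeping: Σ_{F q} e + Σ_{class q} e = total, class sum = E
  have hsumF : (∑ s ∈ F q, netExp b s) + classExp b p x = ∑ s ∈ range (N + 1), netExp b s := by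
    have hE : classExp b p x = ∑ s ∈ classSet b p x, netExp b s := by
      unfold classExp; rw [if_neg (fun h => hcx h.2), add_zero]
    have hcl : classSet b p x = (range (N + 1)).filter (fun s => ¬ (s % p ≠ q % p)) := by
      ext s; simp only [classSet, mem_filter, hqx, not_not, ← hN]
    rw [hE, hcl, hF]
    exact sum_filter_add_sum_filter_not (range (N + 1)) (fun s => s % p ≠ q % p) (fun s => netExp b s)
  -- assemble
  have hgq' : gHat b p (N - q) = 2 * (∏ s ∈ F (N - q), ((s : ℚ) - ((N - q : ℕ) : ℚ)) ^ netExp b s) *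
      (if ¬ (2 : ℤ) ∣ b 0 ∧ ¬ CentreIn b p (N - q) then (b 0 : ℚ) / 2 - ((N - q : ℕ) : ℚ) else 1) := by
    rw [gHat, ← hN]
  have hgq : gHat b p q = 2 * (∏ s ∈ F q, ((s : ℚ) - q) ^ netExp b s) *
      (if ¬ (2 : ℤ) ∣ b 0 ∧ ¬ CentreIn b p q then (b 0 : ℚ) / 2 - q else 1) := by rw [gHat, ← hN]
  rw [hgq', hgq, hprod, prod_congr rfl hfac, prod_mul_distrib, hsign]
  have hb0q : (b 0 : ℚ) = (N : ℚ) := by exact_mod_cast hb0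
  have hT := neg_one_zpow_sum_netExp b hb
  rw [← hN] at hT
  have hexp : (-1 : ℚ) ^ (∑ s ∈ F q, netExp b s) = (-1 : ℚ) ^ (∑ s ∈ range (N + 1), netExp b s) * (-1 : ℚ) ^ (classExp b p x) := by
    rw [← hsumF, zpow_add₀ (by norm_num : (-1 : ℚ) ≠ 0), mul_assoc, ← zpow_add₀ (by norm_num : (-1 : ℚ) ≠ 0),
      ← two_mul, zpow_mul, show ((-1 : ℚ) ^ (2 : ℤ)) = 1 by norm_num, one_zpow, mul_one]
  rw [hexp, hT, zpow_add₀ (by norm_num : (-1 : ℚ) ≠ 0), zpow_one]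
  by_cases hev : (2 : ℤ) ∣ b 0
  · rw [if_pos hev, if_neg (fun h => h.1 hev), if_neg (fun h => h.1 hev)]; ring
  · rw [if_neg hev, if_pos ⟨hev, hcq'⟩, if_pos ⟨hev, hcq⟩, hb0q]
    push_cast [Nat.cast_sub hqN]
    ring

end Summit.KontsevichZagierPeriods.Zeta5Search.CellA

end
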